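import Mathlib

/-!
# Corner inequality `A/j+jp+jjp+mjp` — certificate chunks, part 3
(blind cell PercRepro2, night-2 g28; proofs/NIGHT2-DARC.md §70.7)
-/

namespace Summit.Ventures.PercRepro2.Coin

section JpCornerPart

variable {R : Type*} [Field R] [LinearOrder R] [IsStrictOrderedRing R]

omit [LinearOrder R] [IsStrictOrderedRing R] in
set_option maxHeartbeats 3200000 in
set_option maxRecDepth 100000 in
/-- Chunk 10 of the certificate identity. -/
lemma jp_corner_j_jp_jjp_mjp_chunk10_eq (cO _cM cJ _cMJ cJP cMJP cJJP _cMJJP _uO uM uJ uMJ uJP uMJP uJJP uMJJP : R) :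
    (-8 : R) * uJ * uMJ * uMJP * uMJJP ^ 2 + (-4 : R) * uJ * uMJ * uMJP ^ 2 * uMJJP + (-4 : R) * uM * uJ * uMJ * uMJJP ^ 2 + (-8 : R) * uM ^ 2 * uJ * uMJJP ^ 2 + (-4 : R) * cJJP * uM ^ 2 * uJP * uMJJP + (8 : R) * cMJP * uJ * uMJ * uMJJP ^ 2 + (4 : R) * cMJP * uJ * uMJ * uMJP * uMJJP + (4 : R) * cJP * cJJP * uM ^ 2 * uMJJP + (4 : R) * cJ * uM * uMJ * uMJJP ^ 2 + (8 : R) * cJ * uM ^ 2 * uMJJP ^ 2 + (-4 : R) * cO * uMJ * uJP * uMJJP ^ 2 + (-8 : R) * cO * uM * uJ * uMJP * uMJJP + (-4 : R) * cO * cJJP * uMJ * uJP * uMJJP + (-4 : R) * cO * cJJP * uM * uJJP * uMJJP + (4 : R) * cO * cJJP ^ 2 * uM * uMJJP + (8 : R) * cO * cMJP * uM * uJ * uMJJP + (-4 : R) * cO * cJP * uJP * uMJJP ^ 2 + (4 : R) * cO * cJP * uMJ * uMJJP ^ 2 + (-4 : R) * cO * cJP * uM * uJ * uMJJP + (4 :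 R) * cO * cJP * cJJP * uMJ * uMJJP + (-4 : R) * cO * cJP * cJJP * uJ * uMJJP + (4 : R) * cO * cJP ^ 2 * uMJJP ^ 2 + (-2 : R) * cO * cJ * cJP * uJ * uMJJP + (4 : R) * cO * cJ * cJP * uM * uMJJP + (4 : R) * cO * cJ * cJP * cJJP * uMJJP + (2 : R) * cO * cJ ^ 2 * cJP * uMJJP = (4 : R) * ((cJ - uJ) * cO * (cJP * uM * uMJJP)) + (4 : R) * ((cJ - uJ) * cO * (cJP * cJJP * uMJJP)) + (2 : R) * ((cJ - uJ) * cO * (cJ * cJP * uMJJP)) + (4 : R) * ((cJ - uJ) * uM * (uMJ * uMJJP ^ 2)) + (8 : R) * ((cJ - uJ) * uM * (uM * uMJJP ^ 2)) + (4 : R) * ((cJP - uJP) * cO * (uMJ * uMJJP ^ 2)) + (4 : R) * ((cJP - uJP) * cO * (cJJP * uMJ * uMJJP)) + (4 : R) * ((cJP - uJP) * cO * (cJP * uMJJP ^ 2)) + (4 : R) * ((cJP - uJP) * cJJP * (uM ^ 2 * uMJJP)) + (8 : R) * ((cMJP - uMJP) * cO * (uM * uJ * uMJJP)) + (8 : R)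 * ((cMJP - uMJP) * uJ * (uMJ * uMJJP ^ 2)) + (4 : R) * ((cMJP - uMJP) * uJ * (uMJ * uMJP * uMJJP)) + (4 : R) * ((cJJP - uJJP) * cO * (cJJP * uM * uMJJP)) := by
  ring

set_option maxHeartbeats 3200000 in
set_option maxRecDepth 100000 in
/-- Chunk 10 of the certificate is nonnegative. -/
lemma jp_corner_j_jp_jjp_mjp_chunk10_nonneg (cO cM cJ cMJ cJP cMJP cJJP cMJJP uO uM uJ uMJ uJP uMJP uJJP uMJJP : R)
    (_hcO : 0 ≤ cO) (_hcM : 0 ≤ cM) (_hcJ : 0 ≤ cJ) (_hcMJ : 0 ≤ cMJ) (_hcJP : 0 ≤ cJP) (_hcMJP : 0 ≤ cMJP) (_hcJJP : 0 ≤ cJJP) (_hcMJJP : 0 ≤ cMJJP) (_huO : 0 ≤ uO) (_huM : 0 ≤ uM) (_huJ : 0 ≤ uJ) (_huMJ : 0 ≤ uMJ) (_huJP : 0 ≤ uJP) (_huMJP : 0 ≤ uMJP) (_huJJP : 0 ≤ uJJP) (_huMJJP : 0 ≤ uMJJP)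
    (_hord_o : uO ≤ cO) (_hord_m : uM ≤ cM) (hord_j : uJ ≤ cJ) (_hord_mj : uMJ ≤ cMJ) (hord_jp : uJP ≤ cJP) (hord_mjp : uMJP ≤ cMJP) (hord_jjp : uJJP ≤ cJJP) (_hord_mjjp : uMJJP ≤ cMJJP)
     :
    0 ≤ (-8 : R) * uJ * uMJ * uMJP * uMJJP ^ 2 + (-4 : R) * uJ * uMJ * uMJP ^ 2 * uMJJP + (-4 : R) * uM * uJ * uMJ * uMJJP ^ 2 + (-8 : R) * uM ^ 2 * uJ * uMJJP ^ 2 + (-4 : R) * cJJP * uM ^ 2 * uJP * uMJJP + (8 : R) * cMJP * uJ * uMJ * uMJJP ^ 2 + (4 : R) * cMJP * uJ * uMJ * uMJP * uMJJP + (4 : R) * cJP * cJJP * uM ^ 2 * uMJJP + (4 : R) * cJ * uM * uMJ * uMJJP ^ 2 + (8 : R) * cJ * uM ^ 2 * uMJJP ^ 2 + (-4 : R) * cO * uMJ * uJP * uMJJP ^ 2 + (-8 : R) * cO * uM * uJ * uMJP * uMJJP + (-4 : R) * cO * cJJP * uMJ * uJP * uMJJP + (-4 : R) * cO * cJJP *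 uM * uJJP * uMJJP + (4 : R) * cO * cJJP ^ 2 * uM * uMJJP + (8 : R) * cO * cMJP * uM * uJ * uMJJP + (-4 : R) * cO * cJP * uJP * uMJJP ^ 2 + (4 : R) * cO * cJP * uMJ * uMJJP ^ 2 + (-4 : R) * cO * cJP * uM * uJ * uMJJP + (4 : R) * cO * cJP * cJJP * uMJ * uMJJP + (-4 : R) * cO * cJP * cJJP * uJ * uMJJP + (4 : R) * cO * cJP ^ 2 * uMJJP ^ 2 + (-2 : R) * cO * cJ * cJP * uJ * uMJJP + (4 : R) * cO * cJ * cJP * uM * uMJJP + (4 : R) * cO * cJ * cJP * cJJP * uMJJP + (2 : R) * cO * cJ ^ 2 * cJP * uMJJP := by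
  rw [jp_corner_j_jp_jjp_mjp_chunk10_eq cO cM cJ cMJ cJP cMJP cJJP cMJJP uO uM uJ uMJ uJP uMJP uJJP uMJJP]
  have H200 := mul_nonneg (mul_nonneg (sub_nonneg.2 hord_j) (by positivity : (0:R) ≤ cO)) (by positivity : (0:R) ≤ cJP * uM * uMJJP)
  have H201 := mul_nonneg (mul_nonneg (sub_nonneg.2 hord_j) (by positivity : (0:R) ≤ cO)) (by positivity : (0:R) ≤ cJP * cJJP * uMJJP)
  have H202 := mul_nonneg (mul_nonneg (sub_nonneg.2 hord_j) (by positivity : (0:R) ≤ cO)) (by positivity : (0:R) ≤ cJ * cJP * uMJJP)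
  have H203 := mul_nonneg (mul_nonneg (sub_nonneg.2 hord_j) (by positivity : (0:R) ≤ uM)) (by positivity : (0:R) ≤ uMJ * uMJJP ^ 2)
  have H204 := mul_nonneg (mul_nonneg (sub_nonneg.2 hord_j) (by positivity : (0:R) ≤ uM)) (by positivity : (0:R) ≤ uM * uMJJP ^ 2)
  have H205 := mul_nonneg (mul_nonneg (sub_nonneg.2 hord_jp) (by positivity : (0:R) ≤ cO)) (by positivity : (0:R) ≤ uMJ * uMJJP ^ 2)
  have H206 := mul_nonneg (mul_nonneg (sub_nonneg.2 hord_jp) (by positivity : (0:R) ≤ cO)) (by positivity : (0:R) ≤ cJJP * uMJ * uMJJP)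
  have H207 := mul_nonneg (mul_nonneg (sub_nonneg.2 hord_jp) (by positivity : (0:R) ≤ cO)) (by positivity : (0:R) ≤ cJP * uMJJP ^ 2)
  have H208 := mul_nonneg (mul_nonneg (sub_nonneg.2 hord_jp) (by positivity : (0:R) ≤ cJJP)) (by positivity : (0:R) ≤ uM ^ 2 * uMJJP)
  have H209 := mul_nonneg (mul_nonneg (sub_nonneg.2 hord_mjp) (by positivity : (0:R) ≤ cO)) (by positivity : (0:R) ≤ uM * uJ * uMJJP)
  have H210 := mul_nonneg (mul_nonneg (sub_nonneg.2 hord_mjp) (by positivity : (0:R) ≤ uJ)) (by positivity : (0:R) ≤ uMJ * uMJJP ^ 2)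
  have H211 := mul_nonneg (mul_nonneg (sub_nonneg.2 hord_mjp) (by positivity : (0:R) ≤ uJ)) (by positivity : (0:R) ≤ uMJ * uMJP * uMJJP)
  have H212 := mul_nonneg (mul_nonneg (sub_nonneg.2 hord_jjp) (by positivity : (0:R) ≤ cO)) (by positivity : (0:R) ≤ cJJP * uM * uMJJP)
  exact add_nonneg (add_nonneg (add_nonneg (add_nonneg (add_nonneg (add_nonneg (add_nonneg (add_nonneg (add_nonneg (add_nonneg (add_nonneg (add_nonneg (mul_nonneg (by norm_num : (0:R) ≤ (4 : R)) H200) (mul_nonneg (by norm_num : (0:R) ≤ (4 : R)) H201)) (mul_nonneg (by norm_num : (0:R) ≤ (2 : R)) H202)) (mul_nonneg (by norm_num : (0:R) ≤ (4 : R)) H203)) (mul_nonneg (by norm_num : (0:R) ≤ (8 : R)) H204)) (mul_nonneg (by norm_num : (0:R) ≤ (4 : R)) H205)) (mul_nonneg (by norm_num : (0:R) ≤ (4 : R)) H206)) (mul_nonneg (by norm_num : (0:R) ≤ (4 : R)) H207)) (mul_nonneg (by norm_num : (0:R) ≤ (4 : R)) H208)) (mul_nonneg (by norm_num : (0:R)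 ≤ (8 : R)) H209)) (mul_nonneg (by norm_num : (0:R) ≤ (8 : R)) H210)) (mul_nonneg (by norm_num : (0:R) ≤ (4 : R)) H211)) (mul_nonneg (by norm_num : (0:R) ≤ (4 : R)) H212)

end JpCornerPart

end Summit.Ventures.PercRepro2.Coin
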